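import Mathlib
import Literature.NumberTheory.LFunctions.FeketePolynomial
import Summits.ValiantsHypothesis.ValiantsHypothesis.Theorems.FeketeSOSFeketeBoundedFaninFeketeExactOrder

/-!
# Crux `FeketeSOS.CharPSparseSOS` (stmt-ValiantsHypothesis-14989), line `Sketch` — stub `stub_feketeCuspInf`

The ∞-cusp half of the two-cusp composition: in a field `K` of characteristic `p ≠ 2` the reduced
Fekete polynomial, written as the crux's inlined sum `F̄_p = Σ_{m<p} ((m|p) : K) X^m`, vanishes at
`X = 1` to order EXACTLY `(p-1)/2`, i.e. `(X-1)^{(p-1)/2} ∣ F̄_p` and `(X-1)^{(p-1)/2+1} ∤ F̄_p`.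

Proof.  This is `FeketeBoundedFaninWPU.stub_feketeExactOrder` (Theorems/FeketeSOSFeketeBoundedFaninFeketeExactOrder.lean),
which states exactly this for `(feketePolynomial p).map (Int.castRingHom K)`, transported to the
inlined sum by `map_feketePolynomial` (`(feketePolynomial p).map f = Σ_{m<p} C (f (m|p)) X^m`) and
`eq_intCast` (`Int.castRingHom K z = (z : K)`).
-/

-- `Summit.ValiantsHypothesis.ValiantsHypothesis.…` is the tree's mandated single-conjunct layout (Sub = Summit).
set_option linter.dupNamespace false

namespace Summit.ValiantsHypothesis.ValiantsHypothesis.Theorems.CharPSparseSOSTwoCusp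

open Polynomial Finset
open Literature.NumberTheory.LFunctions

/-- **∞-cusp of the target.** In a field `K` of characteristic `p ≠ 2`, the inlined reduced Fekete
polynomial `Σ_{m<p} ((m|p) : K) X^m` is divisible by `(X-1)^{(p-1)/2}` and not by `(X-1)^{(p-1)/2+1}`
(Mináč–Nguyen–Tân, arXiv:2111.05256, Prop. 5.1; the tree's `stub_feketeExactOrder` read through
`map_feketePolynomial`). [folklore] -/
theorem stub_feketeCuspInf :
    ∀ (K : Type) [Field K] (p : ℕ) [Fact p.Prime] [CharP K p], p ≠ 2 →
      ((X - C (1 : K)) ^ ((p - 1) / 2) ∣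
          ∑ m ∈ Finset.range p, C ((legendreSym p m : ℤ) : K) * X ^ m) ∧
      ¬ ((X - C (1 : K)) ^ ((p - 1) / 2 + 1) ∣
          ∑ m ∈ Finset.range p, C ((legendreSym p m : ℤ) : K) * X ^ m) := by
  intro K _ p _ _ hp2
  have hF : (feketePolynomial p).map (Int.castRingHom K)
      = ∑ m ∈ Finset.range p, C ((legendreSym p m : ℤ) : K) * X ^ m := by
    simp only [map_feketePolynomial, eq_intCast]
  rw [← hF]
  exact FeketeBoundedFaninWPU.stub_feketeExactOrder K p hp2

end Summit.ValiantsHypothesis.ValiantsHypothesis.Theorems.CharPSparseSOSTwoCusp
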